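import Literature.Analysis.FluidPDE.EnergyUniqueness

/-!
# Whole-space integrations by parts for a decaying passive scalar

Topic `Literature/Analysis/FluidPDE`, auxiliary to the energy method for the advection–diffusion
equation `∂ₜθ + u·∇θ = Δθ` of a passive scalar `θ : E → ℝ` in a divergence-free drift `u` on a
finite-dimensional real inner product space `E` (Majda–Bertozzi, *Vorticity and Incompressible
Flow*, §3.1.1, the two integrations by parts of the basic energy identity, here in the scalar
setting; Constantin–Kiselev–Ryzhik–Zlatoš 2008, §1, `‖φ^A(t)‖_{L²}` nonincreasing). The vector-valued
twins for decaying fields are `integral_inner_laplacian_self_eq_neg_gradNormSq` and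
`integral_inner_fderiv_apply_self_eq_zero` of `EnergyUniqueness`; the point of this file is the
transport identity for a drift that is merely `C¹`, divergence free and square integrable — the
class of a classical Leray–Hopf velocity at a fixed time, for which no pointwise decay is available.
The flat-torus analogues (no decay issues) are `Torus.integral_mul_laplacian_eq_neg_sum` and
`Torus.integral_mul_inner_gradient_add_eq_zero` (`PassiveScalarClassicalEnergy`); nothing here
overlaps with the torus passive-scalar cluster `PassiveScalar*`.

## Main statements (all proved, [folklore])

* `integral_mul_laplacian_self_eq_neg_sum_integral_sq`,
  `integral_mul_laplacian_self_eq_neg_integral_norm_fderiv_sq`, `integral_mul_laplacian_self_nonpos`: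
  `∫ θ Δθ = -∑ᵢ ∫ (∂ᵢθ)² = -∫ ‖Dθ‖² ≤ 0` for a `C²` scalar decaying with two derivatives like
  `(1 + ‖x‖)^{-r}`, `dim E < r`.
* `integral_fderiv_apply_eq_neg_integral_mul_divergence_of_hasCompactSupport`,
  `integral_fderiv_apply_eq_zero_of_hasCompactSupport`: `∫ Dψ(v) = -∫ ψ div v (= 0)` for a `C¹`
  field `v` and a compactly supported `C¹` test function `ψ` — no decay of `v` needed.
* `exists_cutoff_seq`: smooth cutoffs `χₙ = χ(·/(n+1))`, `= 1` on `B_{n+1}`, `|χₙ| ≤ 1`,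
  `‖Dχₙ‖ ≤ A` uniformly.
* `integral_mul_inner_gradient_eq_zero_of_memLp`: **the transport term vanishes**,
  `∫ θ ⟪v, ∇θ⟫ = 0`, for a `C¹` divergence-free `v ∈ L²(E)` and a `C¹` scalar `θ` decaying with its
  derivative like `(1 + ‖x‖)^{-r}`, `dim E < r` (cut off, integrate by parts with compact support,
  remove the cutoff by dominated convergence: `|θ| ‖Dθ‖ ‖v‖ ∈ L¹` as `L² · L²`).

## References

* A. J. Majda, A. L. Bertozzi, *Vorticity and Incompressible Flow*, CUP (2002), §3.1.1
  (integrations by parts of the basic energy estimate, p. 87). [MajdaBertozziCUP2002]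
* P. Constantin, A. Kiselev, L. Ryzhik, A. Zlatoš, *Diffusion and mixing in fluid flow*, Ann. of
  Math. 168 (2008), §1 (passive scalar in an incompressible flow, `L²` decay). [ConstantinEtAl2008]
-/

noncomputable section

open MeasureTheory Set Function Filter Topology InnerProductSpace
open scoped ContDiff Laplacian InnerProductSpace RealInnerProductSpace

namespace Literature.Analysis.FluidPDE

variable {E : Type*} [NormedAddCommGroup E] [InnerProductSpace ℝ E] [FiniteDimensional ℝ E]
  [MeasurableSpace E] [BorelSpace E]

/-! ### Green's identity `∫ θ Δθ = -∫ ‖Dθ‖²` for a decaying scalar -/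

/-- **`∫ θ Δθ = -∑ᵢ ∫ (∂ᵢθ)²` in an orthonormal frame.** For a `C²` scalar field `θ : E → ℝ`
decaying with its first two derivatives like `(1 + ‖x‖)^{-r}`, `dim E < r`, and any orthonormal
basis `b`, `∫ θ Δθ = -∑ᵢ ∫ (Dθ(x) bᵢ)²` (integration by parts coordinatewise, no boundary terms;
Majda–Bertozzi §3.1.1). [folklore] -/
theorem integral_mul_laplacian_self_eq_neg_sum_integral_sq {θ : E → ℝ} (hθ2 : ContDiff ℝ 2 θ)
    {C r : ℝ} (hC : 0 ≤ C) (hr : (Module.finrank ℝ E : ℝ) < r)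
    (h0 : ∀ x, ‖θ x‖ ≤ C * (1 + ‖x‖) ^ (-r)) (h1 : ∀ x, ‖fderiv ℝ θ x‖ ≤ C * (1 + ‖x‖) ^ (-r))
    (h2 : ∀ x, ‖fderiv ℝ (fderiv ℝ θ) x‖ ≤ C * (1 + ‖x‖) ^ (-r))
    {ι : Type*} [Fintype ι] (b : OrthonormalBasis ι ℝ E) :
    ∫ x, θ x * (Δ θ) x = -∑ i, ∫ x, (fderiv ℝ θ x (b i)) ^ 2 := by
  have hθc : Continuous θ := hθ2.continuous
  have hDθc : Continuous (fderiv ℝ θ) := hθ2.continuous_fderiv two_ne_zero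
  have hD2 : ContDiff ℝ 1 (fderiv ℝ θ) := hθ2.fderiv_right (m := 1) (by norm_num)
  have hD2c : Continuous (fderiv ℝ (fderiv ℝ θ)) := hD2.continuous_fderiv one_ne_zero
  have hr0 : 0 ≤ r := (Nat.cast_nonneg _).trans hr.le
  -- derivative of `y ↦ Dθ(y) bᵢ`
  have hf : ∀ i x, HasFDerivAt (fun y => fderiv ℝ θ y (b i))
      ((ContinuousLinearMap.apply ℝ ℝ (b i)).comp (fderiv ℝ (fderiv ℝ θ) x)) x :=
    fun i x => (ContinuousLinearMap.apply ℝ ℝ (b i)).hasFDerivAt.comp x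
      (hD2.differentiable one_ne_zero x).hasFDerivAt
  -- integrability of the three products
  have hI1 : ∀ i, Integrable (fun x => fderiv ℝ (fderiv ℝ θ) x (b i) (b i) * θ x)
      (volume : Measure E) := by
    intro i
    refine integrable_of_norm_le_decay_mul_decay (C₁ := C) (C₂ := C) (r' := r)
      (((hD2c.clm_apply continuous_const).clm_apply continuous_const).mul hθc) hr hr0 hC hC
      fun x => ?_
    rw [norm_mul]
    exact mul_le_mul (((norm_apply_orthonormalBasis_le b i _).trans
      (norm_apply_orthonormalBasis_le b i _)).trans (h2 x)) (h0 x) (norm_nonneg _)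
      (mul_nonneg hC (Real.rpow_nonneg (by positivity) _))
  have hI2 : ∀ i, Integrable (fun x => fderiv ℝ θ x (b i) * fderiv ℝ θ x (b i))
      (volume : Measure E) := by
    intro i
    refine integrable_of_norm_le_decay_mul_decay (C₁ := C) (C₂ := C) (r' := r)
      ((hDθc.clm_apply continuous_const).mul (hDθc.clm_apply continuous_const)) hr hr0 hC hC
      fun x => ?_
    rw [norm_mul]
    exact mul_le_mul ((norm_apply_orthonormalBasis_le b i _).trans (h1 x))
      ((norm_apply_orthonormalBasis_le b i _).trans (h1 x)) (norm_nonneg _)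
      (mul_nonneg hC (Real.rpow_nonneg (by positivity) _))
  have hI3 : ∀ i, Integrable (fun x => fderiv ℝ θ x (b i) * θ x) (volume : Measure E) := by
    intro i
    refine integrable_of_norm_le_decay_mul_decay (C₁ := C) (C₂ := C) (r' := r)
      ((hDθc.clm_apply continuous_const).mul hθc) hr hr0 hC hC fun x => ?_
    rw [norm_mul]
    exact mul_le_mul ((norm_apply_orthonormalBasis_le b i _).trans (h1 x)) (h0 x) (norm_nonneg _)
      (mul_nonneg hC (Real.rpow_nonneg (by positivity) _))
  -- integration by parts, one coordinate at a time
  have hibp : ∀ i, ∫ x, fderiv ℝ θ x (b i) * fderiv ℝ θ x (b i) =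
      -∫ x, fderiv ℝ (fderiv ℝ θ) x (b i) (b i) * θ x := by
    intro i
    have H := integral_bilinear_hasFDerivAt_right_eq_neg_left_of_integrable
      (μ := (volume : Measure E)) (f := fun y => fderiv ℝ θ y (b i))
      (f' := fun x => (ContinuousLinearMap.apply ℝ ℝ (b i)).comp (fderiv ℝ (fderiv ℝ θ) x))
      (g := θ) (g' := fderiv ℝ θ) (v := b i) (B := ContinuousLinearMap.mul ℝ ℝ)
      (hI1 i) (hI2 i) (hI3 i)
      (fun x _ => hf i x) (fun x _ => (hθ2.differentiable two_ne_zero x).hasFDerivAt)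
    exact H
  calc ∫ x, θ x * (Δ θ) x
      = ∫ x, ∑ i, fderiv ℝ (fderiv ℝ θ) x (b i) (b i) * θ x := by
        refine integral_congr_ae (Eventually.of_forall fun x => ?_)
        simp only [laplacian_apply_eq_sum_fderiv_fderiv b, Finset.mul_sum]
        exact Finset.sum_congr rfl fun i _ => mul_comm _ _
    _ = ∑ i, ∫ x, fderiv ℝ (fderiv ℝ θ) x (b i) (b i) * θ x :=
        integral_finsetSum _ fun i _ => hI1 i
    _ = -∑ i, ∫ x, (fderiv ℝ θ x (b i)) ^ 2 := by
        rw [← Finset.sum_neg_distrib]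
        refine Finset.sum_congr rfl fun i _ => ?_
        simp only [sq]
        rw [hibp i, neg_neg]

/-- **Green's identity for a decaying scalar: `∫ θ Δθ = -∫ ‖Dθ‖²`.** For a `C²` scalar field
`θ : E → ℝ` decaying with its first two derivatives like `(1 + ‖x‖)^{-r}`, `dim E < r`,
`∫ θ Δθ = -∫ ‖Dθ(x)‖² dx` (here `‖Dθ(x)‖`, the operator norm of the differential, equals `‖∇θ(x)‖`;
integration by parts, no boundary terms; Majda–Bertozzi §3.1.1). [folklore] -/
theorem integral_mul_laplacian_self_eq_neg_integral_norm_fderiv_sq {θ : E → ℝ}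
    (hθ2 : ContDiff ℝ 2 θ) {C r : ℝ} (hC : 0 ≤ C) (hr : (Module.finrank ℝ E : ℝ) < r)
    (h0 : ∀ x, ‖θ x‖ ≤ C * (1 + ‖x‖) ^ (-r)) (h1 : ∀ x, ‖fderiv ℝ θ x‖ ≤ C * (1 + ‖x‖) ^ (-r))
    (h2 : ∀ x, ‖fderiv ℝ (fderiv ℝ θ) x‖ ≤ C * (1 + ‖x‖) ^ (-r)) :
    ∫ x, θ x * (Δ θ) x = -∫ x, ‖fderiv ℝ θ x‖ ^ 2 := by
  set b := stdOrthonormalBasis ℝ E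
  have hDθc : Continuous (fderiv ℝ θ) := hθ2.continuous_fderiv two_ne_zero
  have hr0 : 0 ≤ r := (Nat.cast_nonneg _).trans hr.le
  have hI2 : ∀ i, Integrable (fun x => (fderiv ℝ θ x (b i)) ^ 2) (volume : Measure E) := by
    intro i
    refine integrable_of_norm_le_decay_mul_decay (C₁ := C) (C₂ := C) (r' := r)
      ((hDθc.clm_apply continuous_const).pow 2) hr hr0 hC hC fun x => ?_
    rw [norm_pow, sq]
    exact mul_le_mul ((norm_apply_orthonormalBasis_le b i _).trans (h1 x))
      ((norm_apply_orthonormalBasis_le b i _).trans (h1 x)) (norm_nonneg _)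
      (mul_nonneg hC (Real.rpow_nonneg (by positivity) _))
  rw [integral_mul_laplacian_self_eq_neg_sum_integral_sq hθ2 hC hr h0 h1 h2 b,
    ← integral_finsetSum _ fun i _ => hI2 i]
  congr 1
  refine integral_congr_ae (Eventually.of_forall fun x => ?_)
  simp only [b.norm_dual]

/-- **`∫ θ Δθ = -∫ ‖∇θ‖² ≤ 0` for a decaying scalar.** For a `C²` scalar field `θ : E → ℝ` decaying
with its first two derivatives like `(1 + ‖x‖)^{-r}`, `dim E < r`, the integral of `θ Δθ` is
nonpositive (integration by parts, no boundary terms; Majda–Bertozzi §3.1.1). [folklore] -/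
theorem integral_mul_laplacian_self_nonpos {θ : E → ℝ} (hθ2 : ContDiff ℝ 2 θ)
    {C r : ℝ} (hC : 0 ≤ C) (hr : (Module.finrank ℝ E : ℝ) < r)
    (h0 : ∀ x, ‖θ x‖ ≤ C * (1 + ‖x‖) ^ (-r)) (h1 : ∀ x, ‖fderiv ℝ θ x‖ ≤ C * (1 + ‖x‖) ^ (-r))
    (h2 : ∀ x, ‖fderiv ℝ (fderiv ℝ θ) x‖ ≤ C * (1 + ‖x‖) ^ (-r)) :
    ∫ x, θ x * (Δ θ) x ≤ 0 := by
  rw [integral_mul_laplacian_self_eq_neg_integral_norm_fderiv_sq hθ2 hC hr h0 h1 h2, neg_nonpos]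
  exact integral_nonneg fun x => sq_nonneg _


/-! ### The transport term for an `L²` divergence-free drift -/

/-- **Integration by parts against a divergence, compactly supported test function**: for a `C¹`
vector field `v` and a compactly supported `C¹` scalar `ψ`, `∫ Dψ(x)(v x) dx = -∫ ψ(x) div v(x) dx`
(coordinatewise, via Mathlib's `integral_bilinear_hasFDerivAt_right_eq_neg_left_of_integrable`;
all three products are continuous with compact support). [folklore] -/
theorem integral_fderiv_apply_eq_neg_integral_mul_divergence_of_hasCompactSupport
    {v : E → E} {ψ : E → ℝ} (hv1 : ContDiff ℝ 1 v) (hψ1 : ContDiff ℝ 1 ψ)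
    (hψs : HasCompactSupport ψ) :
    ∫ x, fderiv ℝ ψ x (v x) = -∫ x, ψ x * VectorCalculus.divergence v x := by
  set b := stdOrthonormalBasis ℝ E
  have hvc : Continuous v := hv1.continuous
  have hDvc : Continuous (fderiv ℝ v) := hv1.continuous_fderiv one_ne_zero
  have hψc : Continuous ψ := hψ1.continuous
  have hDψc : Continuous (fderiv ℝ ψ) := hψ1.continuous_fderiv one_ne_zero
  -- integrability of the three products (continuous × compactly supported)
  have hI1 : ∀ i, Integrable (fun x => ⟪b i, fderiv ℝ v x (b i)⟫ * ψ x) (volume : Measure E) :=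
    fun i => ((continuous_const.inner (hDvc.clm_apply continuous_const)).mul hψc)
      |>.integrable_of_hasCompactSupport hψs.mul_left
  have hI2 : ∀ i, Integrable (fun x => ⟪b i, v x⟫ * fderiv ℝ ψ x (b i)) (volume : Measure E) :=
    fun i => ((continuous_const.inner hvc).mul (hDψc.clm_apply continuous_const))
      |>.integrable_of_hasCompactSupport (hψs.fderiv_apply (𝕜 := ℝ) (b i)).mul_left
  have hI3 : ∀ i, Integrable (fun x => ⟪b i, v x⟫ * ψ x) (volume : Measure E) :=
    fun i => ((continuous_const.inner hvc).mul hψc).integrable_of_hasCompactSupport hψs.mul_left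
  -- integration by parts, one coordinate at a time
  have hibp : ∀ i, ∫ x, ⟪b i, v x⟫ * fderiv ℝ ψ x (b i) =
      -∫ x, ⟪b i, fderiv ℝ v x (b i)⟫ * ψ x := by
    intro i
    have H := integral_bilinear_hasFDerivAt_right_eq_neg_left_of_integrable
      (μ := (volume : Measure E)) (f := v) (f' := fderiv ℝ v) (g := ψ) (g' := fderiv ℝ ψ)
      (v := b i) (B := (ContinuousLinearMap.mul ℝ ℝ).comp (innerSL ℝ (b i)))
      (by simpa using hI1 i) (by simpa using hI2 i) (by simpa using hI3 i)
      (fun x _ => (hv1.differentiable one_ne_zero x).hasFDerivAt)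
      (fun x _ => (hψ1.differentiable one_ne_zero x).hasFDerivAt)
    simpa using H
  calc ∫ x, fderiv ℝ ψ x (v x)
      = ∫ x, ∑ i, ⟪b i, v x⟫ * fderiv ℝ ψ x (b i) :=
        integral_congr_ae (Eventually.of_forall fun x => fderiv_apply_eq_sum_inner_mul b _ _)
    _ = ∑ i, ∫ x, ⟪b i, v x⟫ * fderiv ℝ ψ x (b i) := integral_finsetSum _ fun i _ => hI2 i
    _ = -∫ x, ∑ i, ⟪b i, fderiv ℝ v x (b i)⟫ * ψ x := by
        rw [integral_finsetSum _ fun i _ => hI1 i, ← Finset.sum_neg_distrib]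
        exact Finset.sum_congr rfl fun i _ => hibp i
    _ = -∫ x, ψ x * VectorCalculus.divergence v x := by
        congr 1
        refine integral_congr_ae (Eventually.of_forall fun x => ?_)
        simp only [← Finset.sum_mul, divergence_eq_sum_inner_fderiv b v x]
        ring

/-- For a `C¹` divergence-free field `v` and a compactly supported `C¹` scalar `ψ`,
`∫ Dψ(x)(v x) dx = 0`. [folklore] -/
theorem integral_fderiv_apply_eq_zero_of_hasCompactSupport
    {v : E → E} {ψ : E → ℝ} (hv1 : ContDiff ℝ 1 v) (hdiv : VectorCalculus.IsDivFree v)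
    (hψ1 : ContDiff ℝ 1 ψ) (hψs : HasCompactSupport ψ) :
    ∫ x, fderiv ℝ ψ x (v x) = 0 := by
  rw [integral_fderiv_apply_eq_neg_integral_mul_divergence_of_hasCompactSupport hv1 hψ1 hψs]
  simp [hdiv _]

omit [MeasurableSpace E] [BorelSpace E] in
/-- **A sequence of smooth cutoffs with uniformly bounded gradients**: there are `C¹` compactly
supported `χₙ : E → ℝ`, `|χₙ| ≤ 1`, `χₙ = 1` near every point of the open ball of radius `n + 1`,
with `‖Dχₙ‖ ≤ A` uniformly in `n` (take `χₙ(x) = χ(x / (n + 1))` for a fixed smooth bump `χ`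
equal to `1` on the unit ball). [folklore] -/
theorem exists_cutoff_seq :
    ∃ (χ : ℕ → E → ℝ) (A : ℝ), 0 ≤ A ∧ (∀ n, ContDiff ℝ 1 (χ n)) ∧
      (∀ n, HasCompactSupport (χ n)) ∧ (∀ n x, |χ n x| ≤ 1) ∧
      (∀ n x, ‖fderiv ℝ (χ n) x‖ ≤ A) ∧
      (∀ (n : ℕ) (x : E), ‖x‖ < (n : ℝ) + 1 → χ n =ᶠ[𝓝 x] fun _ => 1) := by
  set χ₁ : ContDiffBump (0 : E) := ⟨1, 2, one_pos, one_lt_two⟩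
  have hχd : Differentiable ℝ χ₁ := (χ₁.contDiff (n := 1)).differentiable one_ne_zero
  have hDχc : Continuous (fderiv ℝ χ₁) := (χ₁.contDiff (n := 1)).continuous_fderiv one_ne_zero
  obtain ⟨A, hA⟩ := hDχc.bounded_above_of_compact_support (χ₁.hasCompactSupport.fderiv (𝕜 := ℝ))
  have hA0 : 0 ≤ A := (norm_nonneg _).trans (hA 0)
  set R : ℕ → ℝ := fun n => (n : ℝ) + 1 with hR_def
  have hR : ∀ n, 0 < R n := fun n => by rw [hR_def]; positivity
  have hR1 : ∀ n, 1 ≤ R n := fun n => by simp [hR_def]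
  refine ⟨fun n x => χ₁ ((R n)⁻¹ • x), A, hA0, fun n => ?_, fun n => ?_, fun n x => ?_,
    fun n x => ?_, fun n x hx => ?_⟩
  · exact χ₁.contDiff.comp (contDiff_const_smul _)
  · exact χ₁.hasCompactSupport.comp_smul (inv_ne_zero (hR n).ne')
  · rw [abs_le]
    exact ⟨by linarith [χ₁.nonneg (x := (R n)⁻¹ • x)], χ₁.le_one⟩
  · have h : HasFDerivAt (fun y => χ₁ ((R n)⁻¹ • y))
        ((fderiv ℝ χ₁ ((R n)⁻¹ • x)).comp ((R n)⁻¹ • ContinuousLinearMap.id ℝ E)) x :=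
      (hχd _).hasFDerivAt.comp x ((hasFDerivAt_id x).const_smul _)
    rw [h.fderiv]
    have hsm : ‖(R n)⁻¹ • ContinuousLinearMap.id ℝ E‖ ≤ 1 := by
      rw [norm_smul, Real.norm_eq_abs, abs_inv, abs_of_pos (hR n)]
      calc (R n)⁻¹ * ‖ContinuousLinearMap.id ℝ E‖ ≤ 1 * 1 :=
            mul_le_mul (inv_le_one_of_one_le₀ (hR1 n)) ContinuousLinearMap.norm_id_le
              (norm_nonneg _) zero_le_one
        _ = 1 := one_mul 1
    calc _ ≤ ‖fderiv ℝ χ₁ ((R n)⁻¹ • x)‖ * ‖(R n)⁻¹ • ContinuousLinearMap.id ℝ E‖ :=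
          ContinuousLinearMap.opNorm_comp_le _ _
      _ ≤ A * 1 := mul_le_mul (hA _) hsm (norm_nonneg _) hA0
      _ = A := mul_one A
  · have hball : Metric.ball (0 : E) (R n) ∈ 𝓝 x :=
      Metric.isOpen_ball.mem_nhds (by simpa [hR_def] using hx)
    filter_upwards [hball] with y hy
    apply χ₁.one_of_mem_closedBall
    rw [Metric.mem_ball, dist_zero_right] at hy
    rw [Metric.mem_closedBall, dist_zero_right, norm_smul, Real.norm_eq_abs, abs_inv,
      abs_of_pos (hR n)]
    show (R n)⁻¹ * ‖y‖ ≤ 1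
    rw [inv_mul_le_iff₀ (hR n)]
    linarith

/-- **The transport term vanishes for an `L²` divergence-free drift.** For a `C¹` divergence-free
field `v ∈ L²(E)` (NO decay or growth assumption on `v` or `Dv` beyond `v ∈ L²`) and a `C¹` scalar
`θ` decaying with its derivative like `(1 + ‖x‖)^{-r}`, `dim E < r`:
`∫ θ ⟪v, ∇θ⟫ = ½ ∫ ⟪v, ∇(θ²)⟫ = 0`. Proof: cut off with `χ_R(x) = χ(x/R)` (`χ` a fixed smooth bump,
`= 1` on `B_1`, supported in `B_2`), integrate by parts with compact support
(`∫ D(χ_R θ²)(v) = -∫ χ_R θ² div v = 0`), and let `R → ∞`: `∫ χ_R D(θ²)(v) → ∫ D(θ²)(v)` by dominated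
convergence (`|θ| ‖Dθ‖ ‖v‖` is integrable: `L² · L²`), while `|∫ θ² Dχ_R(v)| ≤ (sup ‖Dχ‖ / R) ∫ θ² ‖v‖ → 0`.
[folklore] -/
theorem integral_mul_inner_gradient_eq_zero_of_memLp
    {v : E → E} {θ : E → ℝ} (hv1 : ContDiff ℝ 1 v) (hdiv : VectorCalculus.IsDivFree v)
    (hv2 : MemLp v 2 (volume : Measure E))
    (hθ1 : ContDiff ℝ 1 θ) {C r : ℝ} (hC : 0 ≤ C) (hr : (Module.finrank ℝ E : ℝ) < r)
    (h0 : ∀ x, ‖θ x‖ ≤ C * (1 + ‖x‖) ^ (-r)) (h1 : ∀ x, ‖fderiv ℝ θ x‖ ≤ C * (1 + ‖x‖) ^ (-r)) :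
    ∫ x, θ x * ⟪v x, gradient θ x⟫ = 0 := by
  obtain ⟨χ, A, hA0, hχ1, hχs, hχb, hDχb, hχ1n⟩ := exists_cutoff_seq (E := E)
  have hvc : Continuous v := hv1.continuous
  have hθd : ∀ x, HasFDerivAt θ (fderiv ℝ θ x) x := fun x =>
    (hθ1.differentiable one_ne_zero x).hasFDerivAt
  have hr0 : 0 ≤ r := (Nat.cast_nonneg _).trans hr.le
  -- the truncated functions `ψₙ = χₙ θ²` and the integrands
  set ψ : ℕ → E → ℝ := fun n x => χ n x * (θ x * θ x) with hψ_def
  have hψ1 : ∀ n, ContDiff ℝ 1 (ψ n) := fun n => (hχ1 n).mul (hθ1.mul hθ1)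
  have hψs : ∀ n, HasCompactSupport (ψ n) := fun n => (hχs n).mul_right
  have hψd : ∀ n x, HasFDerivAt (ψ n) (χ n x • (θ x • fderiv ℝ θ x + θ x • fderiv ℝ θ x) +
      (θ x * θ x) • fderiv ℝ (χ n) x) x := fun n x =>
    ((hχ1 n).differentiable one_ne_zero x).hasFDerivAt.fun_mul ((hθd x).fun_mul (hθd x))
  set F : ℕ → E → ℝ := fun n x => fderiv ℝ (ψ n) x (v x) with hF_def
  set G : E → ℝ := fun x => fderiv ℝ (fun y => θ y * θ y) x (v x) with hG_def
  have hF0 : ∀ n, ∫ x, F n x = 0 := fun n =>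
    integral_fderiv_apply_eq_zero_of_hasCompactSupport hv1 hdiv (hψ1 n) (hψs n)
  -- domination by `K ((1 + ‖x‖)^{-r} + ‖v x‖²)`
  set K : ℝ := (2 + A) * C ^ 2 with hK_def
  set bound : E → ℝ := fun x => K * ((1 + ‖x‖) ^ (-r) + ‖v x‖ ^ 2) with hbound_def
  have hv2' : Integrable (fun x => ‖v x‖ ^ 2) (volume : Measure E) :=
    (memLp_two_iff_integrable_sq_norm hv2.1).1 hv2
  have hbound : Integrable bound (volume : Measure E) :=
    ((integrable_one_add_norm hr).add hv2').const_mul K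
  have hFle : ∀ n x, ‖F n x‖ ≤ bound x := by
    intro n x
    set w : ℝ := (1 + ‖x‖) ^ (-r) with hw_def
    have hw0 : 0 ≤ w := Real.rpow_nonneg (by positivity) _
    have hw1 : w ≤ 1 := rpow_neg_le_one x hr0
    have hθw : |θ x| ≤ C * w := by simpa [Real.norm_eq_abs] using h0 x
    have hDθv : |fderiv ℝ θ x (v x)| ≤ C * w * ‖v x‖ := by
      rw [← Real.norm_eq_abs]
      exact (ContinuousLinearMap.le_opNorm _ _).trans
        (mul_le_mul_of_nonneg_right (h1 x) (norm_nonneg _))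
    have hDχv : |fderiv ℝ (χ n) x (v x)| ≤ A * ‖v x‖ := by
      rw [← Real.norm_eq_abs]
      exact (ContinuousLinearMap.le_opNorm _ _).trans
        (mul_le_mul_of_nonneg_right (hDχb n x) (norm_nonneg _))
    have hχx : |χ n x| ≤ 1 := hχb n x
    have e : F n x = χ n x * (θ x * fderiv ℝ θ x (v x) + θ x * fderiv ℝ θ x (v x)) +
        θ x * θ x * fderiv ℝ (χ n) x (v x) := by
      simp only [hF_def, (hψd n x).fderiv, add_apply, smul_apply,
        smul_eq_mul]
    rw [e, Real.norm_eq_abs, hbound_def, hK_def]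
    calc |χ n x * (θ x * fderiv ℝ θ x (v x) + θ x * fderiv ℝ θ x (v x)) +
          θ x * θ x * fderiv ℝ (χ n) x (v x)|
        ≤ |χ n x| * (|θ x| * |fderiv ℝ θ x (v x)| + |θ x| * |fderiv ℝ θ x (v x)|) +
          |θ x| * |θ x| * |fderiv ℝ (χ n) x (v x)| := by
          refine (abs_add_le _ _).trans (le_of_eq ?_)
          rw [abs_mul, abs_mul, abs_mul, ← abs_mul (θ x) (fderiv ℝ θ x (v x)), ← two_mul,
            ← two_mul, abs_mul, abs_two]
      _ ≤ 1 * (C * w * (C * w * ‖v x‖) + C * w * (C * w * ‖v x‖)) +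
          C * w * (C * w) * (A * ‖v x‖) := by
          gcongr
      _ = (2 + A) * C ^ 2 * w * (w * ‖v x‖) := by ring
      _ ≤ (2 + A) * C ^ 2 * 1 * (w * ‖v x‖) := by gcongr
      _ ≤ (2 + A) * C ^ 2 * (w + ‖v x‖ ^ 2) := by
          rw [mul_one]
          gcongr
          nlinarith [mul_nonneg hw0 (sub_nonneg.2 hw1), sq_nonneg (w - ‖v x‖ / 2),
            sq_nonneg ‖v x‖, norm_nonneg (v x)]
  -- pointwise convergence: `Fₙ x = G x` as soon as `‖x‖ < n + 1`
  have hlim : ∀ x, Tendsto (fun n => F n x) atTop (𝓝 (G x)) := by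
    intro x
    refine tendsto_const_nhds.congr' ?_
    filter_upwards [eventually_ge_atTop ⌈‖x‖⌉₊] with n hn
    have hxn : ‖x‖ < n + 1 := by
      have h1 : ‖x‖ ≤ (⌈‖x‖⌉₊ : ℝ) := Nat.le_ceil _
      have h2 : (⌈‖x‖⌉₊ : ℝ) ≤ n := by exact_mod_cast hn
      linarith
    have hev : ψ n =ᶠ[𝓝 x] fun y => θ y * θ y := by
      filter_upwards [hχ1n n x hxn] with y hy
      simp [hψ_def, hy]
    simp only [hF_def, hG_def, hev.fderiv_eq]
  -- dominated convergence: `0 = ∫ Fₙ → ∫ G`, so `∫ G = 0`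
  have hT := tendsto_integral_of_dominated_convergence bound
    (fun n => (((hψ1 n).continuous_fderiv one_ne_zero).clm_apply hvc).aestronglyMeasurable)
    hbound (fun n => Eventually.of_forall (hFle n)) (Eventually.of_forall hlim)
  have hG0 : ∫ x, G x = 0 := by
    have : Tendsto (fun _ : ℕ => (0 : ℝ)) atTop (𝓝 (∫ x, G x)) := hT.congr fun n => hF0 n
    exact (tendsto_const_nhds_iff.1 this).symm
  -- `G = 2 θ ⟪v, ∇θ⟫`
  have hGe : ∀ x, G x = 2 * (θ x * ⟪v x, gradient θ x⟫) := by
    intro x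
    simp only [hG_def, ((hθd x).fun_mul (hθd x)).fderiv, add_apply, smul_apply,
      smul_eq_mul]
    rw [gradient, real_inner_comm, toDual_symm_apply]
    ring
  have h2 : ∫ x, G x = 2 * ∫ x, θ x * ⟪v x, gradient θ x⟫ := by
    rw [← integral_const_mul]
    exact integral_congr_ae (Eventually.of_forall hGe)
  linarith [hG0, h2]

end Literature.Analysis.FluidPDE
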